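import Summits.AnomalousDissipation.AnomalousDissipation.Theorems.NeutralTaylorWavesTaylorWaveQuasiSteadyHierarchyEnergyLemmas
import Summits.AnomalousDissipation.AnomalousDissipation.Theorems.NeutralTaylorWavesTaylorWaveQuasiSteadyHierarchyEikonal
import Summits.AnomalousDissipation.AnomalousDissipation.Theorems.NeutralTaylorWavesTaylorWaveQuasiSteadyHierarchyUnfold
import Mathlib.Algebra.QuadraticDiscriminant

/-!
# Leading energy identity of the ε-free hierarchy (line `windfibred`, rev 3)
# (crux stmt-AnomalousDissipation-16293, `NeutralTaylorWaves.TaylorWaveQuasiSteady`)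

**Theorem (`leading_energy_identity`).**  For every formal solution of order `N ≥ 1` of the registered ε-free core
`stub_hierarchyW` — i.e. whenever `divCoeff … 0 ≡ divCoeff … 1 ≡ 0` and `hierarchyCoeff … 0 ≡ hierarchyCoeff … 1 ≡ 0`,
with `j i₀ ≠ 0`, `∂_{i₀}G ≡ 0`, smooth `G`, `P_a`, `Q_a` —

  `∫_{T⁴} |k|²‖∂_θ P_0‖² dy = ∫_{T⁴} ⟪f(slow y), P_0(y)⟫ dy`:

the leading Taylor-scale dissipation (the `ε₀` of the crux, `stub_hierarchyW`'s loudness clause) EQUALS the work of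
the force on the leading profile — the formal, EXACT counterpart of the field-level necessary condition
`⟨f, w_n⟩ → ε₀` of `Negative/LoadBearing.lean` (`integral_inner_residual_self`) and of the work ceiling of
`Negative/WorkCeiling.lean`; since `f ∘ slow` has no fast dependence, only the θ-MEAN of `P_0` (the mean flow) receives
work.  Consequences for any attack on the core: `f ≠ 0` and `P̄_0 ≠ 0` on a formal solution with `ε₀ > 0`;
`ε₀ ≤ ‖f‖_{L²(T³)} · ‖P_0‖_{L²(T⁴)}`.

Proof: the remaining pieces of `∫ ⟪M_1, P_0⟫ = 0` — the pressure does no work (`integral_pressure_eq_zero`: `∂_θQ_0 = 0`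
from the eikonal order, `d_0 = d_1 = 0`, two integrations by parts), the slow and fast drift terms are total derivatives
(`integral_inner_sDeriv_self_eq_zero`, `integral_inner_fDeriv_self_eq_zero`) — and the assembly with the three integrals
of `…HierarchyEnergyLemmas.lean` through the triangular form `Unfold.hierarchyCoeff_of_le` (`t = 1`).
Registered as the tools sub-stub `stub_hierarchyWEnergy` (last theorem). [folklore]
-/

-- `Summit.<Summit>.<Problem>` is the tree's mandated summit-side namespace (CONVENTIONS §2); for this
-- single-conjunct summit the two coincide, so the duplicate is deliberate.
set_option linter.dupNamespace false

noncomputable section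

open scoped BigOperators InnerProductSpace ContDiff
open MeasureTheory
open Literature.Analysis.FunctionSpaces Literature.Analysis.FunctionSpaces.Torus

namespace Summit.AnomalousDissipation.AnomalousDissipation.Theorems.TaylorWaveQuasiSteady.Energy

open Summit.AnomalousDissipation.AnomalousDissipation.Theorems.TaylorWaveQuasiSteady

section Body

variable {j : Fin 3 → ℤ} {G : UnitAddTorus (Fin 3) → ℝ} {f : UnitAddTorus (Fin 3) → EuclideanSpace ℝ (Fin 3)} {N : ℕ}
  {P : ℕ → UnitAddTorus (Fin 4) → EuclideanSpace ℝ (Fin 3)} {Q : ℕ → UnitAddTorus (Fin 4) → ℝ} {c : ℕ → ℝ}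

/-- `∂_θ (∑ₗ (U)ₗ kₗ) = ∑ᵢ (kᵢ ∂_θ U)ᵢ` for a smooth profile `U` (the phase gradient has no fast dependence). [folklore] -/
theorem partialDeriv_last_sum_coord_mul_phaseGrad (hG : IsSmooth G) {U : UnitAddTorus (Fin 4) → EuclideanSpace ℝ (Fin 3)}
    (hU : IsSmooth U) (y : UnitAddTorus (Fin 4)) :
    partialDeriv (Fin.last 3) (fun y => ∑ l : Fin 3, (U y) l * phaseGrad j G l (slow y)) y =
      ∑ i : Fin 3, (fDeriv j G i U y) i := by
  have hU1 : IsContDiff 1 U := hU.isContDiff (by simp)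
  rw [partialDeriv_finset_sum Finset.univ
    (fun l _ => (isSmooth_mul (isSmooth_coord hU l) (isSmooth_phaseGrad_slow j hG l)).isContDiff (by simp))]
  refine Finset.sum_congr rfl fun l _ => ?_
  have h3 : (fun y => (U y) l * phaseGrad j G l (slow y)) = fun y => phaseGrad j G l (slow y) * (U y) l := by
    funext y; ring
  rw [h3, partialDeriv_last_phaseGrad_mul j hG l (isSmooth_coord hU l), partialDeriv_apply_coord' hU1]
  simp only [fDeriv, PiLp.smul_apply, smul_eq_mul]

/-- **The pressure terms do no work**: with `∂_θ Q_0 = 0` (eikonal order), `d_0 = 0` and `d_1 = 0`,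
`∫ ⟪∇_x Q_0 + k ∂_θ Q_1, P_0⟫ = 0`. [folklore] -/
theorem integral_pressure_eq_zero (hG : IsSmooth G) (hP : ∀ a, IsSmooth (P a)) (hQ : ∀ a, IsSmooth (Q a))
    (hd0 : ∀ y, ∑ i : Fin 3, (fDeriv j G i (P 0) y) i = 0)
    (hd1 : ∀ y, (∑ i : Fin 3, (sDeriv i (P 0) y) i) + ∑ i : Fin 3, (fDeriv j G i (P 1) y) i = 0)
    (hq0 : ∀ y, partialDeriv (Fin.last 3) (Q 0) y = 0) :
    ∫ y, ⟪WithLp.toLp 2 (fun i : Fin 3 => sDeriv i (Q 0) y + fDeriv j G i (Q 1) y), P 0 y⟫_ℝ = 0 := by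
  have hP0 := hP 0
  have hP1 := hP 1
  have hQ0 := hQ 0
  have hQ1 := hQ 1
  have hP01 : IsContDiff 1 (P 0) := hP0.isContDiff (by simp)
  -- the two fast "momenta" `π_a = ∑ₗ (P_a)ₗ kₗ`
  have hπ0s : IsSmooth (fun y => ∑ l : Fin 3, (P 0 y) l * phaseGrad j G l (slow y)) :=
    isSmooth_fsum Finset.univ fun l _ => isSmooth_mul (isSmooth_coord hP0 l) (isSmooth_phaseGrad_slow j hG l)
  have hπ1s : IsSmooth (fun y => ∑ l : Fin 3, (P 1 y) l * phaseGrad j G l (slow y)) :=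
    isSmooth_fsum Finset.univ fun l _ => isSmooth_mul (isSmooth_coord hP1 l) (isSmooth_phaseGrad_slow j hG l)
  -- pointwise form of the integrand
  have hpt : ∀ y, ⟪WithLp.toLp 2 (fun i : Fin 3 => sDeriv i (Q 0) y + fDeriv j G i (Q 1) y), P 0 y⟫_ℝ =
      (∑ i : Fin 3, partialDeriv i.castSucc (Q 0) y * (P 0 y) i)
        + partialDeriv (Fin.last 3) (Q 1) y * ∑ l : Fin 3, (P 0 y) l * phaseGrad j G l (slow y) := by
    intro y
    rw [inner_eq_sum_mul, Finset.mul_sum, ← Finset.sum_add_distrib]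
    refine Finset.sum_congr rfl fun i _ => ?_
    simp only [sDeriv, fDeriv, smul_eq_mul]
    ring
  simp_rw [hpt]
  have iA : ∀ i : Fin 3, Integrable (fun y => partialDeriv i.castSucc (Q 0) y * (P 0 y) i) :=
    fun i => (isSmooth_mul (hQ0.partialDeriv _) (isSmooth_coord hP0 i)).integrable
  have iA' : Integrable (fun y => ∑ i : Fin 3, partialDeriv i.castSucc (Q 0) y * (P 0 y) i) :=
    (isSmooth_fsum Finset.univ fun i _ => isSmooth_mul (hQ0.partialDeriv _) (isSmooth_coord hP0 i)).integrable
  have iB : Integrable (fun y => partialDeriv (Fin.last 3) (Q 1) y * ∑ l : Fin 3, (P 0 y) l * phaseGrad j G l (slow y)) :=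
    (isSmooth_mul (hQ1.partialDeriv _) hπ0s).integrable
  rw [integral_add iA' iB]
  -- A: `∫ ∑ᵢ ∂ᵢQ_0 (P_0)ᵢ = -∫ Q_0 div_x P_0 = ∫ Q_0 ∂_θ π_1 = -∫ (∂_θ Q_0) π_1 = 0`
  have hA : ∫ y, ∑ i : Fin 3, partialDeriv i.castSucc (Q 0) y * (P 0 y) i =
      ∫ y, Q 0 y * partialDeriv (Fin.last 3) (fun y => ∑ l : Fin 3, (P 1 y) l * phaseGrad j G l (slow y)) y := by
    rw [integral_finsetSum _ fun i _ => iA i]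
    have hi : ∀ i : Fin 3, ∫ y, partialDeriv i.castSucc (Q 0) y * (P 0 y) i =
        -∫ y, Q 0 y * (sDeriv i (P 0) y) i := by
      intro i
      rw [integral_partialDeriv_mul_eq_neg hQ0 (isSmooth_coord hP0 i) i.castSucc]
      congr 1
      refine integral_congr_ae (ae_of_all _ fun y => ?_)
      dsimp only
      rw [partialDeriv_apply_coord' hP01]
      rfl
    simp_rw [hi]
    rw [Finset.sum_neg_distrib, ← integral_finsetSum _ fun i _ =>
      (isSmooth_mul hQ0 (isSmooth_coord (FormalExpansion.isSmooth_sDeriv hP0 i) i)).integrable]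
    rw [← integral_neg]
    refine integral_congr_ae (ae_of_all _ fun y => ?_)
    dsimp only
    rw [← Finset.mul_sum, partialDeriv_last_sum_coord_mul_phaseGrad hG hP1, ← mul_neg]
    congr 1
    linarith [hd1 y]
  have hA' : ∫ y, Q 0 y * partialDeriv (Fin.last 3) (fun y => ∑ l : Fin 3, (P 1 y) l * phaseGrad j G l (slow y)) y = 0 := by
    have h := integral_partialDeriv_mul_eq_neg hπ1s hQ0 (Fin.last 3)
    simp_rw [hq0, mul_zero, integral_zero, neg_zero] at h
    rw [← h]
    exact integral_congr_ae (ae_of_all _ fun y => mul_comm _ _)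
  -- B: `∫ (∂_θ Q_1) π_0 = -∫ Q_1 ∂_θ π_0 = -∫ Q_1 d_0 = 0`
  have hB : ∫ y, partialDeriv (Fin.last 3) (Q 1) y * ∑ l : Fin 3, (P 0 y) l * phaseGrad j G l (slow y) = 0 := by
    rw [integral_partialDeriv_mul_eq_neg hQ1 hπ0s (Fin.last 3)]
    simp_rw [partialDeriv_last_sum_coord_mul_phaseGrad hG hP0, hd0, mul_zero, integral_zero, neg_zero]
  rw [hA, hA', hB, add_zero]

/-- **The slow drift does no work**: `∫ ⟪∂_{x₂} P_0, P_0⟫ = 0`. [folklore] -/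
theorem integral_inner_sDeriv_self_eq_zero (hP : ∀ a, IsSmooth (P a)) (i : Fin 3) :
    ∫ y, ⟪sDeriv i (P 0) y, P 0 y⟫_ℝ = 0 := by
  have hP0 := hP 0
  have h := integral_mul_inner_partialDeriv_eq (isSmooth_const (1 : ℝ)) hP0 hP0 i.castSucc
  have h0 : ∀ y, partialDeriv i.castSucc (fun _ : UnitAddTorus (Fin 4) => (1 : ℝ)) y = 0 := fun y => by
    simp [Torus.partialDeriv, Torus.lineDeriv]
  simp_rw [h0, zero_mul, integral_zero, sub_zero, one_mul] at h
  have hsym : (fun y => ⟪P 0 y, partialDeriv i.castSucc (P 0) y⟫_ℝ) =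
      fun y => ⟪partialDeriv i.castSucc (P 0) y, P 0 y⟫_ℝ := funext fun y => real_inner_comm _ _
  rw [hsym] at h
  simp only [sDeriv]
  linarith

/-- **The fast drift does no work**: `∫ ⟪k₂ ∂_θ P_0, P_0⟫ = 0`. [folklore] -/
theorem integral_inner_fDeriv_self_eq_zero (hG : IsSmooth G) (hP : ∀ a, IsSmooth (P a)) (i : Fin 3) :
    ∫ y, ⟪fDeriv j G i (P 0) y, P 0 y⟫_ℝ = 0 := by
  have hP0 := hP 0
  have hpt : ∀ y, ⟪fDeriv j G i (P 0) y, P 0 y⟫_ℝ =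
      phaseGrad j G i (slow y) * ⟪partialDeriv (Fin.last 3) (P 0) y, P 0 y⟫_ℝ := fun y => real_inner_smul_left _ _ _
  simp_rw [hpt]
  have h := integral_mul_inner_partialDeriv_eq (isSmooth_phaseGrad_slow j hG i) hP0 hP0 (Fin.last 3)
  have h0 : ∀ y, partialDeriv (Fin.last 3) (fun z : UnitAddTorus (Fin 4) => phaseGrad j G i (slow z)) y = 0 :=
    fun y => partialDeriv_last_comp_slow (fun x => phaseGrad j G i x) y
  simp_rw [h0, zero_mul, integral_zero, sub_zero] at h
  have hsym : (fun y => phaseGrad j G i (slow y) * ⟪P 0 y, partialDeriv (Fin.last 3) (P 0) y⟫_ℝ) =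
      fun y => phaseGrad j G i (slow y) * ⟪partialDeriv (Fin.last 3) (P 0) y, P 0 y⟫_ℝ :=
    funext fun y => by rw [real_inner_comm]
  rw [hsym] at h
  linarith

/-! ## Energy §3 The leading energy identity -/

/-- **Leading energy identity of the ε-free hierarchy.**  For a formal solution of order `N ≥ 1` — orders `0` and `1` of
`hierarchyCoeff` and of `divCoeff` vanish — with `j i₀ ≠ 0` and `∂_{i₀} G ≡ 0` (so that `|k| > 0`):
`∫_{T⁴} |k|²‖∂_θ P_0‖² = ∫_{T⁴} ⟪f ∘ slow, P_0⟫`, i.e. the leading (Taylor-scale) dissipation `ε₀` equals the work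
of the force on the leading profile (and, `f ∘ slow` being θ-independent, on its θ-mean: the MEAN FLOW receives all the
work).  Proof: pair the order-one equation `M_1 = 0` (`Unfold.hierarchyCoeff_of_le`, `t = 1`) with `P_0` and integrate;
two-scale transport is energy-neutral by `d_1 = 0` (`integral_transport_eq_zero`), the `P_0·k`-transport and drift of
`P_1` vanish by the eikonal order (`Eikonal.eikonal_of_order_zero`, `integral_eikonal_transport_eq_zero`), the pressure
does no work by `∂_θQ_0 = 0`, `d_0 = d_1 = 0` (`integral_pressure_eq_zero`), the drift terms are total derivatives, and
the viscous term integrates by parts to `∫ |k|²‖∂_θP_0‖²` (`integral_viscous_eq_dissDensity`). [folklore] -/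
theorem leading_energy_identity {i₀ : Fin 3} (hj : j i₀ ≠ 0) (hG0 : ∀ x, partialDeriv i₀ G x = 0)
    (hG : IsSmooth G) (hP : ∀ a, IsSmooth (P a)) (hQ : ∀ a, IsSmooth (Q a)) (hN : 1 ≤ N)
    (hd0 : ∀ y, divCoeff j G N P 0 y = 0) (hd1 : ∀ y, divCoeff j G N P 1 y = 0)
    (hM0 : ∀ y, hierarchyCoeff j G f N P Q c 0 y = 0) (hM1 : ∀ y, hierarchyCoeff j G f N P Q c 1 y = 0) :
    ∫ y, dissDensity j G (P 0) y = ∫ y, ⟪f (slow y), P 0 y⟫_ℝ := by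
  have hP0 := hP 0
  have hP1 := hP 1
  have hQ0 := hQ 0
  have hQ1 := hQ 1
  -- the divergence orders, unfolded
  have hd0' : ∀ y, ∑ i : Fin 3, (fDeriv j G i (P 0) y) i = 0 := fun y => by
    rw [← Eikonal.divCoeff_zero j G N P y]
    exact hd0 y
  have hd1' : ∀ y, (∑ i : Fin 3, (sDeriv i (P 0) y) i) + ∑ i : Fin 3, (fDeriv j G i (P 1) y) i = 0 := fun y => by
    rw [← Unfold.divCoeff_succ j G N P 0 hN y]
    exact hd1 y
  -- eikonal consequences of the order `0`
  have heik : ∀ y, partialDeriv (Fin.last 3) (Q 0) y = 0 ∧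
      ((∑ l : Fin 3, (P 0 y) l * phaseGrad j G l (slow y)) - c 0 * phaseGrad j G 2 (slow y)) •
        partialDeriv (Fin.last 3) (P 0) y = 0 :=
    fun y => Eikonal.eikonal_of_order_zero hj hG0 hM0 hd0 y
  -- the seven pieces of `⟪M_1, P_0⟫`
  set e1 : UnitAddTorus (Fin 4) → ℝ := fun y => ⟪∑ l : Fin 3, (P 0 y) l • sDeriv l (P 0) y, P 0 y⟫_ℝ with he1
  set e2 : UnitAddTorus (Fin 4) → ℝ := fun y => ⟪∑ l : Fin 3, (P 1 y) l • fDeriv j G l (P 0) y, P 0 y⟫_ℝ with he2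
  set e3 : UnitAddTorus (Fin 4) → ℝ := fun y =>
    ⟪((∑ l : Fin 3, (P 0 y) l * phaseGrad j G l (slow y)) - c 0 * phaseGrad j G 2 (slow y)) •
      partialDeriv (Fin.last 3) (P 1) y, P 0 y⟫_ℝ with he3
  set e4 : UnitAddTorus (Fin 4) → ℝ := fun y => -⟪∑ i : Fin 3, fDeriv j G i (fDeriv j G i (P 0)) y, P 0 y⟫_ℝ with he4
  set e5 : UnitAddTorus (Fin 4) → ℝ := fun y =>
    ⟪WithLp.toLp 2 (fun i : Fin 3 => sDeriv i (Q 0) y + fDeriv j G i (Q 1) y), P 0 y⟫_ℝ with he5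
  set e6 : UnitAddTorus (Fin 4) → ℝ := fun y => -(c 0 * ⟪sDeriv 2 (P 0) y, P 0 y⟫_ℝ) with he6
  set e7 : UnitAddTorus (Fin 4) → ℝ := fun y => -(c 1 * ⟪fDeriv j G 2 (P 0) y, P 0 y⟫_ℝ) with he7
  -- pointwise: `⟪f, P_0⟫ = e1 + … + e7`
  have key : ∀ y, ⟪f (slow y), P 0 y⟫_ℝ = e1 y + e2 y + e3 y + e4 y + e5 y + e6 y + e7 y := by
    intro y
    have h1 := hM1 y
    rw [Unfold.hierarchyCoeff_of_le j G f N P Q c 1 le_rfl hN y,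
      if_neg (show ¬ (3 ≤ 1) by norm_num), if_neg (show ¬ (2 ≤ 1) by norm_num), if_pos rfl] at h1
    simp only [Finset.sum_range_succ, Finset.sum_range_zero, zero_add, Nat.sub_self, Nat.sub_zero, sub_zero] at h1
    have h2 := sub_eq_zero.1 h1
    have h3 : ⟪((∑ l : Fin 3, (P 0 y) l * phaseGrad j G l (slow y)) - c 0 * phaseGrad j G 2 (slow y)) •
        partialDeriv (Fin.last 3) (P 1) y, P 0 y⟫_ℝ =
        ⟪∑ l : Fin 3, (P 0 y) l • fDeriv j G l (P 1) y, P 0 y⟫_ℝ - c 0 * ⟪fDeriv j G 2 (P 1) y, P 0 y⟫_ℝ := by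
      rw [← real_inner_smul_left, ← inner_sub_left]
      congr 1
      simp only [fDeriv, smul_smul, sub_smul, Finset.sum_smul]
    simp only [he1, he2, he3, he4, he5, he6, he7]
    rw [h3, ← h2]
    simp only [inner_add_left, inner_sub_left, real_inner_smul_left]
    ring
  -- the values of the seven integrals
  have L12 : (∫ y, e1 y) + ∫ y, e2 y = 0 := integral_transport_eq_zero hG hP hd1'
  have L3 : ∫ y, e3 y = 0 := integral_eikonal_transport_eq_zero hG hP hd0' (fun y => (heik y).2)
  have L4 : ∫ y, e4 y = ∫ y, dissDensity j G (P 0) y := by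
    rw [← integral_viscous_eq_dissDensity (P := P) hG hP, ← integral_neg]
  have L5 : ∫ y, e5 y = 0 := integral_pressure_eq_zero hG hP hQ hd0' hd1' (fun y => (heik y).1)
  have L6 : ∫ y, e6 y = 0 := by
    simp only [he6]
    rw [integral_neg, integral_const_mul, integral_inner_sDeriv_self_eq_zero hP 2, mul_zero, neg_zero]
  have L7 : ∫ y, e7 y = 0 := by
    simp only [he7]
    rw [integral_neg, integral_const_mul, integral_inner_fDeriv_self_eq_zero hG hP 2, mul_zero, neg_zero]
  -- integrability of the pieces (all continuous on the compact torus)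
  have hW : ∀ i, IsSmooth (fDeriv j G i (P 0)) := fun i => FormalExpansion.isSmooth_fDeriv j hG i hP0
  have i1 : Integrable e1 :=
    ((isSmooth_fsum Finset.univ fun l _ => (isSmooth_coord hP0 l).smul' (FormalExpansion.isSmooth_sDeriv hP0 l)).inner
      hP0).integrable
  have i2 : Integrable e2 :=
    ((isSmooth_fsum Finset.univ fun l _ => (isSmooth_coord hP1 l).smul' (hW l)).inner hP0).integrable
  have i3 : Integrable e3 := by
    have hg : IsSmooth (fun y : UnitAddTorus (Fin 4) =>
        (∑ l : Fin 3, (P 0 y) l * phaseGrad j G l (slow y)) - c 0 * phaseGrad j G 2 (slow y)) :=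
      (isSmooth_fsum Finset.univ fun l _ => isSmooth_mul (isSmooth_coord hP0 l) (isSmooth_phaseGrad_slow j hG l)).sub
        (isSmooth_mul (isSmooth_const (c 0)) (isSmooth_phaseGrad_slow j hG 2))
    exact ((hg.smul' (hP1.partialDeriv (Fin.last 3))).inner hP0).integrable
  have i4 : Integrable e4 :=
    ((isSmooth_fsum Finset.univ fun i _ => FormalExpansion.isSmooth_fDeriv j hG i (hW i)).inner hP0).integrable.neg
  have i5 : Integrable e5 := by
    have hv : IsSmooth (fun y : UnitAddTorus (Fin 4) =>
        WithLp.toLp 2 (fun i : Fin 3 => sDeriv i (Q 0) y + fDeriv j G i (Q 1) y)) := by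
      have hc : ∀ i : Fin 3, IsSmooth (fun y : UnitAddTorus (Fin 4) => sDeriv i (Q 0) y + fDeriv j G i (Q 1) y) :=
        fun i => (FormalExpansion.isSmooth_sDeriv hQ0 i).add (FormalExpansion.isSmooth_fDeriv j hG i hQ1)
      unfold IsSmooth
      rw [show Torus.lift (fun y : UnitAddTorus (Fin 4) =>
          WithLp.toLp 2 (fun i : Fin 3 => sDeriv i (Q 0) y + fDeriv j G i (Q 1) y)) =
          fun z => WithLp.toLp 2 (fun i : Fin 3 => Torus.lift (fun y => sDeriv i (Q 0) y + fDeriv j G i (Q 1) y) z)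
          from rfl]
      exact (contDiff_piLp 2).2 fun i => hc i
    exact (hv.inner hP0).integrable
  have i6 : Integrable e6 := (isSmooth_mul (isSmooth_const (c 0)) ((FormalExpansion.isSmooth_sDeriv hP0 2).inner hP0)).integrable.neg
  have i7 : Integrable e7 := (isSmooth_mul (isSmooth_const (c 1)) ((hW 2).inner hP0)).integrable.neg
  have s2 : Integrable (fun y => e1 y + e2 y) := i1.add i2
  have s3 : Integrable (fun y => e1 y + e2 y + e3 y) := s2.add i3
  have s4 : Integrable (fun y => e1 y + e2 y + e3 y + e4 y) := s3.add i4
  have s5 : Integrable (fun y => e1 y + e2 y + e3 y + e4 y + e5 y) := s4.add i5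
  have s6 : Integrable (fun y => e1 y + e2 y + e3 y + e4 y + e5 y + e6 y) := s5.add i6
  -- integrate the pointwise identity and collect
  have hint : ∫ y, ⟪f (slow y), P 0 y⟫_ℝ = ∫ y, (e1 y + e2 y + e3 y + e4 y + e5 y + e6 y + e7 y) :=
    integral_congr_ae (ae_of_all _ key)
  rw [hint, integral_add s6 i7, integral_add s5 i6, integral_add s4 i5, integral_add s3 i4, integral_add s2 i3,
    integral_add i1 i2]
  linarith

end Body


/-! ## Energy §4 Corollaries (appended): the formal work ceiling; the mean flow receives the work -/

/-- **Fubini over the fast fibre for slow functions**: `∫_{T⁴} g(slow y) dy = ∫_{T³} g`. [folklore] -/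
theorem integral_comp_slow {g : UnitAddTorus (Fin 3) → ℝ} (hg : Continuous g) :
    ∫ y : UnitAddTorus (Fin 4), g (slow y) = ∫ x, g x := by
  have hslowc : Continuous (slow : UnitAddTorus (Fin 4) → UnitAddTorus (Fin 3)) :=
    continuous_pi fun l => continuous_apply _
  rw [DissipationLaw.integral_eq_integral_integral_snoc (Φ := fun y : UnitAddTorus (Fin 4) => g (slow y)) (hg.comp hslowc)]
  have hsl : ∀ (x : UnitAddTorus (Fin 3)) (s : UnitAddCircle),
      slow (@Fin.snoc 3 (fun _ => UnitAddCircle) x s : UnitAddTorus (Fin 4)) = x :=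
    fun x s => funext fun l => by simp only [slow, Fin.snoc_castSucc]
  simp only [hsl]
  rw [integral_const, probReal_univ, one_smul]

/-- **The formal work ceiling** (appended 2026-08-17, registered sub-stub `stub_hierarchyWWorkCeiling`): orders `0`, `1` with
`‖P_0‖² ≤ E` pointwise force `(∫ |k|²‖∂_θP_0‖²)² ≤ E · ∫_{T³} ‖f‖²` (`ε₀² ≤ E‖f‖₂²`; exact profile-level counterpart of
`Negative/WorkCeiling.lean`): `0 ≤ ∫‖t f∘slow − P_0‖² ≤ t²‖f‖₂² − 2tε₀ + E` for every `t`, then `discrim_le_zero`. [folklore] -/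
theorem formal_work_ceiling {j : Fin 3 → ℤ} {i₀ : Fin 3} {G : UnitAddTorus (Fin 3) → ℝ}
    {f : UnitAddTorus (Fin 3) → EuclideanSpace ℝ (Fin 3)} {N : ℕ}
    {P : ℕ → UnitAddTorus (Fin 4) → EuclideanSpace ℝ (Fin 3)} {Q : ℕ → UnitAddTorus (Fin 4) → ℝ} {c : ℕ → ℝ} {E : ℝ}
    (hj : j i₀ ≠ 0) (hG0 : ∀ x, partialDeriv i₀ G x = 0) (hG : IsSmooth G) (hf : IsSmooth f)
    (hP : ∀ a, IsSmooth (P a)) (hQ : ∀ a, IsSmooth (Q a)) (hN : 1 ≤ N)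
    (hd0 : ∀ y, divCoeff j G N P 0 y = 0) (hd1 : ∀ y, divCoeff j G N P 1 y = 0)
    (hM0 : ∀ y, hierarchyCoeff j G f N P Q c 0 y = 0) (hM1 : ∀ y, hierarchyCoeff j G f N P Q c 1 y = 0)
    (hE : ∀ y, ‖P 0 y‖ ^ 2 ≤ E) :
    (∫ y, dissDensity j G (P 0) y) ^ 2 ≤ E * ∫ x, ‖f x‖ ^ 2 := by
  have hP0 := hP 0
  have hfs : IsSmooth (fun y : UnitAddTorus (Fin 4) => f (slow y)) := ResidualTransfer.isSmooth_comp_slow hf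
  set W : ℝ := ∫ y, dissDensity j G (P 0) y with hW
  set F : ℝ := ∫ x, ‖f x‖ ^ 2 with hF
  have hWork : W = ∫ y, ⟪f (slow y), P 0 y⟫_ℝ := leading_energy_identity hj hG0 hG hP hQ hN hd0 hd1 hM0 hM1
  have hFslow : ∫ y : UnitAddTorus (Fin 4), ‖f (slow y)‖ ^ 2 = F :=
    integral_comp_slow (g := fun x => ‖f x‖ ^ 2) (hf.continuous.norm.pow 2)
  have hEint : ∫ y : UnitAddTorus (Fin 4), ‖P 0 y‖ ^ 2 ≤ E := by
    calc ∫ y : UnitAddTorus (Fin 4), ‖P 0 y‖ ^ 2 ≤ ∫ _y : UnitAddTorus (Fin 4), E :=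
          integral_mono hP0.norm_sq.integrable (integrable_const E) fun y => hE y
      _ = E := by rw [integral_const, probReal_univ, one_smul]
  -- the quadratic `F t² − 2W t + E ≥ 0` for every real `t`
  have hquad : ∀ t : ℝ, 0 ≤ F * (t * t) + (-(2 * W)) * t + E := by
    intro t
    have hpt : ∀ y, ‖t • f (slow y) - P 0 y‖ ^ 2 =
        t * t * ‖f (slow y)‖ ^ 2 - 2 * t * ⟪f (slow y), P 0 y⟫_ℝ + ‖P 0 y‖ ^ 2 := by
      intro y
      rw [norm_sub_sq_real, norm_smul, mul_pow, Real.norm_eq_abs, sq_abs, real_inner_smul_left]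
      ring
    have h0 : 0 ≤ ∫ y, ‖t • f (slow y) - P 0 y‖ ^ 2 := integral_nonneg fun y => by positivity
    have i1 : Integrable (fun y : UnitAddTorus (Fin 4) => t * t * ‖f (slow y)‖ ^ 2) := (hfs.norm_sq.integrable).const_mul _
    have i2 : Integrable (fun y : UnitAddTorus (Fin 4) => 2 * t * ⟪f (slow y), P 0 y⟫_ℝ) :=
      ((hfs.inner hP0).integrable).const_mul _
    have i3 : Integrable (fun y : UnitAddTorus (Fin 4) => ‖P 0 y‖ ^ 2) := hP0.norm_sq.integrable
    simp_rw [hpt] at h0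
    have i12 : Integrable (fun y : UnitAddTorus (Fin 4) =>
        t * t * ‖f (slow y)‖ ^ 2 - 2 * t * ⟪f (slow y), P 0 y⟫_ℝ) := i1.sub i2
    rw [integral_add i12 i3, integral_sub i1 i2, integral_const_mul, integral_const_mul, hFslow, ← hWork] at h0
    have hE' : t * t * F - 2 * t * W + E ≥ t * t * F - 2 * t * W + ∫ y : UnitAddTorus (Fin 4), ‖P 0 y‖ ^ 2 := by
      linarith [hEint]
    have hre : F * (t * t) + (-(2 * W)) * t + E = t * t * F - 2 * t * W + E := by ring
    rw [hre]
    exact h0.trans hE'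
  have hdisc := discrim_le_zero hquad
  rw [discrim] at hdisc
  have hre : (-(2 * W)) ^ 2 - 4 * F * E = 4 * (W ^ 2 - E * F) := by ring
  rw [hre] at hdisc
  linarith


/-- **The mean flow receives all the work.**  Under the hypotheses of the leading energy identity,
`∫_{T⁴} |k|²‖∂_θP_0‖² = ∫_{T³} ⟪f(x), P̄_0(x)⟫ dx` with the fibre (θ-) mean `P̄_0(x) = ∫_{T¹} P_0(x, s) ds`: the force being
θ-independent, only the θ-mean of the leading profile is worked on (so `ε₀ > 0` forces `f ≠ 0` AND `P̄_0 ≠ 0`). [folklore] -/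
theorem dissipation_eq_work_on_fibre_mean {j : Fin 3 → ℤ} {i₀ : Fin 3} {G : UnitAddTorus (Fin 3) → ℝ}
    {f : UnitAddTorus (Fin 3) → EuclideanSpace ℝ (Fin 3)} {N : ℕ}
    {P : ℕ → UnitAddTorus (Fin 4) → EuclideanSpace ℝ (Fin 3)} {Q : ℕ → UnitAddTorus (Fin 4) → ℝ} {c : ℕ → ℝ}
    (hj : j i₀ ≠ 0) (hG0 : ∀ x, partialDeriv i₀ G x = 0) (hG : IsSmooth G) (hf : IsSmooth f)
    (hP : ∀ a, IsSmooth (P a)) (hQ : ∀ a, IsSmooth (Q a)) (hN : 1 ≤ N)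
    (hd0 : ∀ y, divCoeff j G N P 0 y = 0) (hd1 : ∀ y, divCoeff j G N P 1 y = 0)
    (hM0 : ∀ y, hierarchyCoeff j G f N P Q c 0 y = 0) (hM1 : ∀ y, hierarchyCoeff j G f N P Q c 1 y = 0) :
    ∫ y, dissDensity j G (P 0) y =
      ∫ x : UnitAddTorus (Fin 3), ⟪f x, ∫ s : UnitAddCircle, P 0 (@Fin.snoc 3 (fun _ => UnitAddCircle) x s)⟫_ℝ := by
  have hP0 := hP 0
  rw [leading_energy_identity hj hG0 hG hP hQ hN hd0 hd1 hM0 hM1]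
  have hslowc : Continuous (slow : UnitAddTorus (Fin 4) → UnitAddTorus (Fin 3)) :=
    continuous_pi fun l => continuous_apply _
  have hcont : Continuous fun y : UnitAddTorus (Fin 4) => ⟪f (slow y), P 0 y⟫_ℝ :=
    (hf.continuous.comp hslowc).inner hP0.continuous
  rw [DissipationLaw.integral_eq_integral_integral_snoc' (Φ := fun y : UnitAddTorus (Fin 4) => ⟪f (slow y), P 0 y⟫_ℝ) hcont]
  have hsl : ∀ (x : UnitAddTorus (Fin 3)) (s : UnitAddCircle),
      slow (@Fin.snoc 3 (fun _ => UnitAddCircle) x s : UnitAddTorus (Fin 4)) = x :=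
    fun x s => funext fun l => by simp only [slow, Fin.snoc_castSucc]
  simp only [hsl]
  refine integral_congr_ae (ae_of_all _ fun x => ?_)
  have hsnoc : Continuous fun s : UnitAddCircle => (@Fin.snoc 3 (fun _ => UnitAddCircle) x s : UnitAddTorus (Fin 4)) :=
    continuous_pi fun l => by
      refine Fin.lastCases ?_ (fun i => ?_) l
      · simp only [Fin.snoc_last]; exact continuous_id
      · simp only [Fin.snoc_castSucc]; exact continuous_const
  have hint : Integrable (fun s : UnitAddCircle => P 0 (@Fin.snoc 3 (fun _ => UnitAddCircle) x s)) :=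
    (hP0.continuous.comp hsnoc).integrable_of_hasCompactSupport (HasCompactSupport.of_compactSpace _)
  exact integral_inner hint (f x)

/-- **stub_hierarchyWWorkCeiling** (registered tools sub-stub of stmt-AnomalousDissipation-16293): the formal work
ceiling `ε₀² ≤ E‖f‖₂²` and the identity 'the mean flow receives all the work', explicit-argument forms of
`formal_work_ceiling` and `dissipation_eq_work_on_fibre_mean`. [folklore] -/
theorem stub_hierarchyWWorkCeiling : (∀ (j : Fin 3 → ℤ) (i₀ : Fin 3) (G : UnitAddTorus (Fin 3) → ℝ) (f : UnitAddTorus (Fin 3) → EuclideanSpace ℝ (Fin 3)) (N : ℕ) (P : ℕ → UnitAddTorus (Fin 4) → EuclideanSpace ℝ (Fin 3)) (Q : ℕ → UnitAddTorus (Fin 4) → ℝ) (c : ℕ → ℝ) (E : ℝ), j i₀ ≠ 0 → (∀ x, Literature.Analysis.FunctionSpaces.Torus.partialDeriv i₀ G x = 0) → Literature.Analysis.FunctionSpaces.Torus.IsSmooth G → Literature.Analysis.FunctionSpaces.Torus.IsSmooth f → (∀ a, Literature.Analysis.FunctionSpaces.Torus.IsSmooth (P a)) → (∀ a, Literature.Analysis.FunctionSpaces.Torus.IsSmooth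 (Q a)) → 1 ≤ N → (∀ y, divCoeff j G N P 0 y = 0) → (∀ y, divCoeff j G N P 1 y = 0) → (∀ y, hierarchyCoeff j G f N P Q c 0 y = 0) → (∀ y, hierarchyCoeff j G f N P Q c 1 y = 0) → (∀ y, ‖P 0 y‖ ^ 2 ≤ E) → (∫ y, dissDensity j G (P 0) y) ^ 2 ≤ E * ∫ x, ‖f x‖ ^ 2) ∧ (∀ (j : Fin 3 → ℤ) (i₀ : Fin 3) (G : UnitAddTorus (Fin 3) → ℝ) (f : UnitAddTorus (Fin 3) → EuclideanSpace ℝ (Fin 3)) (N : ℕ) (P : ℕ → UnitAddTorus (Fin 4) → EuclideanSpace ℝ (Fin 3)) (Q : ℕ → UnitAddTorus (Fin 4) → ℝ) (c : ℕ → ℝ), j i₀ ≠ 0 → (∀ x, Literature.Analysis.FunctionSpaces.Torus.partialDeriv i₀ G x = 0) → Literature.Analysis.FunctionSpaces.Torus.IsSmooth G → Literature.Analysis.FunctionSpaces.Torus.IsSmooth f → (∀ a, Literature.Analysis.FunctionSpaces.Torus.IsSmooth (P a)) → (∀ a, Literature.Analysis.FunctionSpaces.Torus.IsSmooth (Q a))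 → 1 ≤ N → (∀ y, divCoeff j G N P 0 y = 0) → (∀ y, divCoeff j G N P 1 y = 0) → (∀ y, hierarchyCoeff j G f N P Q c 0 y = 0) → (∀ y, hierarchyCoeff j G f N P Q c 1 y = 0) → ∫ y, dissDensity j G (P 0) y = ∫ x : UnitAddTorus (Fin 3), inner ℝ (f x) (∫ s : UnitAddCircle, P 0 (@Fin.snoc 3 (fun _ => UnitAddCircle) x s))) :=
  ⟨fun _ _ _ _ _ _ _ _ _ hj hG0 hG hf hP hQ hN hd0 hd1 hM0 hM1 hE =>
      formal_work_ceiling hj hG0 hG hf hP hQ hN hd0 hd1 hM0 hM1 hE,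
    fun _ _ _ _ _ _ _ _ hj hG0 hG hf hP hQ hN hd0 hd1 hM0 hM1 =>
      dissipation_eq_work_on_fibre_mean hj hG0 hG hf hP hQ hN hd0 hd1 hM0 hM1⟩


/-! ## The registered tools sub-stub -/

/-- **stub_hierarchyWEnergy** (registered tools sub-stub of stmt-AnomalousDissipation-16293): the leading energy identity,
explicit-argument form of `leading_energy_identity`. [folklore] -/
theorem stub_hierarchyWEnergy : ∀ (j : Fin 3 → ℤ) (i₀ : Fin 3) (G : UnitAddTorus (Fin 3) → ℝ) (f : UnitAddTorus (Fin 3) → EuclideanSpace ℝ (Fin 3)) (N : ℕ) (P : ℕ → UnitAddTorus (Fin 4) → EuclideanSpace ℝ (Fin 3)) (Q : ℕ → UnitAddTorus (Fin 4) → ℝ) (c : ℕ → ℝ), j i₀ ≠ 0 → (∀ x, Literature.Analysis.FunctionSpaces.Torus.partialDeriv i₀ G x = 0) → Literature.Analysis.FunctionSpaces.Torus.IsSmooth G → (∀ a, Literature.Analysis.FunctionSpaces.Torus.IsSmooth (P a)) → (∀ a, Literature.Analysis.FunctionSpaces.Torus.IsSmooth (Q a)) → 1 ≤ N → (∀ y,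 divCoeff j G N P 0 y = 0) → (∀ y, divCoeff j G N P 1 y = 0) → (∀ y, hierarchyCoeff j G f N P Q c 0 y = 0) → (∀ y, hierarchyCoeff j G f N P Q c 1 y = 0) → ∫ y, dissDensity j G (P 0) y = ∫ y, inner ℝ (f (slow y)) (P 0 y) :=
  fun _ _ _ _ _ _ _ _ hj hG0 hG hP hQ hN hd0 hd1 hM0 hM1 => leading_energy_identity hj hG0 hG hP hQ hN hd0 hd1 hM0 hM1

end Summit.AnomalousDissipation.AnomalousDissipation.Theorems.TaylorWaveQuasiSteady.Energy

end
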